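import Summits.BirchSwinnertonDyer.BirchSwinnertonDyer.Theorems.ManinLocalTwoThreeBracketSturmOneEightyNineA
import Summits.BirchSwinnertonDyer.BirchSwinnertonDyer.Theorems.ManinLocalTwoThreeBracketSturmOneEightyNineB
import Summits.BirchSwinnertonDyer.BirchSwinnertonDyer.Theorems.ManinLocalTwoThreeBracketSturmOneEightyNineC
import HarnessLib

/-!
# Level 189 = 3³·7 (C3 domain, `27 ∥ 189`), THREE OF FOUR CLASSES fact-free: `|c| = 1` and `3 ∤ c` for every lattice-optimal `X₀(189)`-datum off the row `a₅(W) = 1`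

Cell bsd-f2-manin, route `ManinLocalTwoThree`, crux C3 `ManinPrimeToThreeAtNine` (stmt-BirchSwinnertonDyer-22968), prover seat p3 gen 26.  The classes `189a`
(`a₅ = −1`), `189b` (`a₅ = −3`), `189c` (`a₅ = 3`) are closed in `…BracketSturmOneEightyNineA/B/C` (an's `M₂`-pinning, this seat's (1/9)-bridge, multi-term
`η`-denominators and STAGED weight-12 certificates at depth 289); the fourth row `a₅ = 1` (class `189d`, modular degree `36 > dim M₂(189)/2`) has NO weight-2
ratio presentation and is NOT treated.  Here: **`abs_maninConstant_eq_one_oneEightyNine_of_lFunction_five_ne_one`** — `|c| = 1` for every globally minimal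
elliptic `W/ℚ` with `a₅(W) ≠ 1` and every `X₀(189)`-datum with the lattice clause — and the `3 ∤ c` corollary.

HONEST FRAMING: unconditional (standard axioms), no modularity, no CDT, no printed Manin fact, no Cremona table; a PARTIAL level (one row excluded by an
explicit hypothesis) — nothing here proves C3 (∀ N), C2, Manin's conjecture or BSD; items 22967/22968 stay OPEN.  No definition, no named fact, no sorry.
[cite: Manin1972, Prop. 1.4] [cite: AgasheRibetStein2006, §§1–2] [cite: CremonaAlgorithms1997, Table 1 (189a–d)]
-/

set_option autoImplicit false
-- lint-debt: the directory name repeats the summit name (sibling precedent `ManinLocalTwoThreeManinConstantNinety.lean`)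
set_option linter.dupNamespace false

noncomputable section

open Complex
open scoped MatrixGroups ModularForm
open ModularForm CongruenceSubgroup
open Literature.NumberTheory.EllipticCurves Literature.NumberTheory.EllipticCurves.ModularForms

namespace Summit.BirchSwinnertonDyer.BirchSwinnertonDyer.Theorems.ManinLocalTwoThree.LevelOneEightyNine

/-- **LEVEL 189, three of four rows — `|c| = 1` for every globally minimal elliptic `W/ℚ` with `a₅(W) ≠ 1` and every `X₀(189)`-datum with the lattice
clause** (`row_cases` + the class files `189a/b/c`).  No modularity, no CDT, no printed Manin fact. [cite: Manin1972, Prop. 1.4] [cite: AgasheRibetStein2006, §§1–2] -/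
theorem abs_maninConstant_eq_one_oneEightyNine_of_lFunction_five_ne_one (W : WeierstrassCurve ℚ) [W.IsElliptic] [W.IsGloballyMinimal]
    (D : ModularParametrizationData W 189) (h5 : W.LFunction 5 ≠ 1)
    (hopt : ∀ z ∈ D.L.lattice, ∃ w ∈ periodLattice D.f, z = D.c * w) : |D.maninConstant| = 1 := by
  rcases row_cases D with h | h | h | h
  · exact abs_maninConstant_eq_one_a W D h hopt
  · exact abs_maninConstant_eq_one_b W D h hopt
  · exact abs_maninConstant_eq_one_c W D h hopt
  · exact absurd h h5

/-- **Corollary: `3 ∤ c`** (indeed no `q` with `|q| ≠ 1` divides `c`) for every lattice-optimal `X₀(189)`-datum of a globally minimal elliptic `W` with `a₅(W) ≠ 1`. [folklore] -/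
theorem not_dvd_maninConstant_oneEightyNine_of_lFunction_five_ne_one (W : WeierstrassCurve ℚ) [W.IsElliptic] [W.IsGloballyMinimal]
    (D : ModularParametrizationData W 189) (h5 : W.LFunction 5 ≠ 1)
    (hopt : ∀ z ∈ D.L.lattice, ∃ w ∈ periodLattice D.f, z = D.c * w) {q : ℤ} (hq : q.natAbs ≠ 1) : ¬ q ∣ D.maninConstant := by
  intro h
  have h1 := abs_maninConstant_eq_one_oneEightyNine_of_lFunction_five_ne_one W D h5 hopt
  have hn : D.maninConstant.natAbs = 1 := by
    rw [Int.abs_eq_natAbs] at h1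
    exact_mod_cast h1
  have h2 : q.natAbs ∣ 1 := hn ▸ Int.natAbs_dvd_natAbs.mpr h
  exact hq (Nat.dvd_one.mp h2)

/-- **C3 shape at `N = 189` off the `189d` row**: `3² ∣ 189` and every lattice-optimal `X₀(189)`-datum of every globally minimal elliptic curve with `a₅ ≠ 1`
has `|c| = 1` and `3 ∤ c`. [cite: CremonaAlgorithms1997, Table 1 (189a–c)] -/
theorem maninPrimeToThreeAtNine_oneEightyNine_of_lFunction_five_ne_one : 3 ^ 2 ∣ 189 ∧
    ∀ (W : WeierstrassCurve ℚ) [W.IsElliptic] [W.IsGloballyMinimal] (D : ModularParametrizationData W 189), W.LFunction 5 ≠ 1 →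
      (∀ z ∈ D.L.lattice, ∃ w ∈ periodLattice D.f, z = D.c * w) →
        |D.maninConstant| = 1 ∧ ¬ (3 : ℤ) ∣ D.maninConstant :=
  ⟨by norm_num, fun W _ _ D h5 hopt ↦
    ⟨abs_maninConstant_eq_one_oneEightyNine_of_lFunction_five_ne_one W D h5 hopt,
     not_dvd_maninConstant_oneEightyNine_of_lFunction_five_ne_one W D h5 hopt (by decide)⟩⟩

end Summit.BirchSwinnertonDyer.BirchSwinnertonDyer.Theorems.ManinLocalTwoThree.LevelOneEightyNine

end
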